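import Summits.CriticalPhenomena.Ising3DConformalLimit.Theses.CoerciveSharpness
import Summits.CriticalPhenomena.Ising3DConformalLimit.Theorems.PlantedPinningMoebiusLimitExistsTwoLeaf
import Summits.CriticalPhenomena.Ising3DConformalLimit.Theorems.HyperoctahedralRPExistsScaleCovariantLimitFoldedCurrentUniqueness
import Literature.Probability.LatticeModels.CriticalScalingDimension
import HarnessLib

/-!
# Split of crux `CoerciveSharpness.MoebiusLimit` (item stmt-CriticalPhenomena-1344) into THREE lattice-side leaves,
# the first of which is discharged by this route's own hypothesis `DimensionPinned`
(crux-strategist decomposition for route `CoerciveSharpness`, `--supports stmt-CriticalPhenomena-1344`, 2026-08-17; landed verbatim by lead c16 of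
crux 1344 — only the two anchor headers `MoebiusLimit_of_subs` / `twoPointDoubling_of_dimensionPinned` rewritten in the registered arrow form)

The imported complement `MoebiusLimit` ("the critical Ising correlators on `ℤ³` have a non-degenerate, Möbius-covariant
pointwise scaling limit"; one term shared by fourteen routes) is, by landed kernel-checked factorisations,

* `MoebiusLimit ⟺ ExistsScaleCovariantLimit (stmt-1981) ∧ InversionUpgradeNormalised (stmt-1982)`
  (`MoebiusLimitExistsTwoLeaf.coerciveSharpness_MoebiusLimit_iff_leaves`, p142965, after item stmt-1980 became a theorem), and
* `ExistsScaleCovariantLimit ⟺ TwoPointDoubling (stmt-6150) ∧ ClusterSetTotallyDisconnected (stmt-4659)`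
  (`Cruxes.ExistsScaleCovariantLimit.FoldedCurrentRepulsion.crux_iff_doubling_and_totallyDisconnected`, p139907).

Route `CoerciveSharpness` is special among the fourteen: its deciding theorem `closes` ALREADY consumes the shared item
`DimensionPinned` (stmt-4662: two-sided pure-power bounds `c‖x‖^{-(1+η)} ≤ ⟨σ₀σ_x⟩_{β_c(3)} ≤ C‖x‖^{-(1+η)}`), and two-sided
power bounds give ALL-SCALE DOUBLING of the axial two-point function in one line:
`⟨σ₀σ_{2n e₁}⟩ ≥ c (2n)^{-(1+η)} = (c/C)·2^{-(1+η)} · C n^{-(1+η)} ≥ (c/C)·2^{-(1+η)} ⟨σ₀σ_{n e₁}⟩`.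
That is exactly the leaf `TwoPointDoubling` on which the existence chain (crux stmt-1981, leads c13/c14) is blocked.

Main results:
* `twoPointDoubling_of_isPowerBounded` / `twoPointDoubling_of_hasIsingEtaBounds` / `twoPointDoubling_of_dimensionPinned` —
  item 4662 ⟹ item 6150 (elementary; recorded so that the doubling leaf of this route's split is visibly discharged by `h₄` of `closes`);
* `MoebiusLimit_of_subs : TwoPointDoubling → ClusterSetTotallyDisconnected → InversionUpgradeNormalised → CoerciveSharpness.MoebiusLimit`
  — the GLUE of the three-leaf split (pure composition of the two landed factorisations);
* `MoebiusLimit_iff_subs` — each leaf is necessary (the split loses nothing);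
* `MoebiusLimit_of_dimensionPinned` — on this route the imported complement reduces to `ClusterSetTotallyDisconnected ∧
  InversionUpgradeNormalised` given the route's own `DimensionPinned`;
* `closes_residual` — the route's deciding theorem re-assembled with `MoebiusLimit` replaced by the two genuinely residual leaves.

References: H. Duminil-Copin, *100 years of the (critical) Ising model on the hypercubic lattice*, Proc. ICM 2022, §4.2.1
(two-sided bounds, `η`), §8.4 p. 29 (existence / conformal covariance open on `ℤ³`); M. Aizenman, H. Duminil-Copin, Ann. Math. 194
(2021) §5 (regular scales, doubling); P. Di Francesco, P. Mathieu, D. Sénéchal, *Conformal Field Theory* (1997) §4.3.1.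
No definitions, no `sorry`.
-/

noncomputable section

open Literature.Probability.LatticeModels
open Summit.CriticalPhenomena.Ising3DConformalLimit.Theses

namespace Summit.CriticalPhenomena.Ising3DConformalLimit.CoerciveSharpnessMoebiusLimitSplit

/-- **Two-sided power bounds give axial doubling.** If `c‖x‖^{-k} ≤ G x ≤ C‖x‖^{-k}` for all `x ≠ 0` (`c > 0`), then
`G (2n e₁) ≥ κ · G (n e₁)` for all `n ≥ 1` with `κ = c·2^{-k}/C > 0`. Elementary. [folklore] -/
theorem twoPointDoubling_of_isPowerBounded {G : Site 3 → ℝ} {k : ℝ} (h : IsPowerBounded G k) :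
    ∃ κ : ℝ, 0 < κ ∧ ∀ n : ℕ, 1 ≤ n →
      κ * G (Pi.single 0 (n : ℤ)) ≤ G (Pi.single 0 (2 * (n : ℤ))) := by
  obtain ⟨c, C, hc, hb⟩ := h
  -- the axis points are non-zero and have norm `n`, `2n`
  have hne : ∀ m : ℤ, m ≠ 0 → (Pi.single (0 : Fin 3) m : Site 3) ≠ 0 := by
    intro m hm h0
    have := congr_fun h0 0
    simp at this
    exact hm this
  -- `C > 0` (compare the two bounds at `e₁`)
  have hC : 0 < C := by
    obtain ⟨h1, h2⟩ := hb _ (hne 1 one_ne_zero)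
    have hr : 0 < ‖(Pi.single (0 : Fin 3) (1 : ℤ) : Site 3)‖ ^ (-k) := by
      apply Real.rpow_pos_of_pos
      rw [norm_single_axis]; simp
    have hpos : 0 < C * ‖(Pi.single (0 : Fin 3) (1 : ℤ) : Site 3)‖ ^ (-k) :=
      lt_of_lt_of_le (mul_pos hc hr) (h1.trans h2)
    by_contra hle
    push Not at hle
    nlinarith
  refine ⟨c * (2 : ℝ) ^ (-k) / C, by positivity, ?_⟩
  intro n hn
  have hn0 : (n : ℤ) ≠ 0 := by exact_mod_cast (by omega : n ≠ 0)
  have h2n0 : 2 * (n : ℤ) ≠ 0 := by omega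
  obtain ⟨-, hup⟩ := hb _ (hne _ hn0)
  obtain ⟨hlow, -⟩ := hb _ (hne _ h2n0)
  have hnpos : (0 : ℝ) < n := by exact_mod_cast (by omega : 0 < n)
  have hn1 : ‖(Pi.single (0 : Fin 3) (n : ℤ) : Site 3)‖ = (n : ℝ) := by
    rw [norm_single_axis]; push_cast; exact abs_of_nonneg hnpos.le
  have hn2 : ‖(Pi.single (0 : Fin 3) (2 * (n : ℤ)) : Site 3)‖ = 2 * (n : ℝ) := by
    rw [norm_single_axis]; push_cast; exact abs_of_nonneg (by positivity)
  rw [hn1] at hup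
  rw [hn2] at hlow
  calc c * (2 : ℝ) ^ (-k) / C * G (Pi.single 0 (n : ℤ))
      ≤ c * (2 : ℝ) ^ (-k) / C * (C * (n : ℝ) ^ (-k)) :=
        mul_le_mul_of_nonneg_left hup (by positivity)
    _ = c * ((2 : ℝ) * n) ^ (-k) := by
        rw [Real.mul_rpow (by norm_num) hnpos.le]
        field_simp
    _ ≤ G (Pi.single 0 (2 * (n : ℤ))) := hlow

/-- **Two-sided `η`-bounds (`HasIsingEtaBounds 3 η`) give `TwoPointDoubling` (item stmt-6150).**
[cite: DuminilCopinICM2022, §4.2.1 p. 12] -/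
theorem twoPointDoubling_of_hasIsingEtaBounds {η : ℝ} (h : HasIsingEtaBounds 3 η) :
    MirrorHoelderCompactness.TwoPointDoubling :=
  twoPointDoubling_of_isPowerBounded h

/-- **Item stmt-4662 `DimensionPinned` ⟹ item stmt-6150 `TwoPointDoubling`** (this route's own hypothesis `h₄` of `closes`
discharges the doubling leaf of the split below). [cite: DuminilCopinICM2022, §4.2.1 p. 12] -/
theorem twoPointDoubling_of_dimensionPinned : Summit.CriticalPhenomena.Ising3DConformalLimit.Theses.CoerciveSharpness.DimensionPinned → Summit.CriticalPhenomena.Ising3DConformalLimit.Theses.MirrorHoelderCompactness.TwoPointDoubling := by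
  rintro ⟨η, hη⟩
  exact twoPointDoubling_of_hasIsingEtaBounds hη

/-- **GLUE of the three-leaf split of `CoerciveSharpness.MoebiusLimit` (item stmt-1344).**
`TwoPointDoubling (6150) → ClusterSetTotallyDisconnected (4659) → InversionUpgradeNormalised (1982) → MoebiusLimit`:
doubling and total disconnectedness of the cluster set are existence (p139907), existence and the inversion upgrade are the
crux (p142965). [cite: DuminilCopinICM2022, §8.4 p. 29] -/
theorem MoebiusLimit_of_subs : Summit.CriticalPhenomena.Ising3DConformalLimit.Theses.MirrorHoelderCompactness.TwoPointDoubling → Summit.CriticalPhenomena.Ising3DConformalLimit.Theses.ClusterRigidity.ClusterSetTotallyDisconnected → Summit.CriticalPhenomena.Ising3DConformalLimit.Theses.HyperoctahedralRP.InversionUpgradeNormalised → Summit.CriticalPhenomena.Ising3DConformalLimit.Theses.CoerciveSharpness.MoebiusLimit :=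
  fun h6150 h4659 h1982 =>
    MoebiusLimitExistsTwoLeaf.coerciveSharpness_MoebiusLimit_of_leaves
      (Cruxes.ExistsScaleCovariantLimit.FoldedCurrentRepulsion.crux_iff_doubling_and_totallyDisconnected.mpr
        ⟨h6150, h4659⟩) h1982

/-- **`CoerciveSharpness.MoebiusLimit ⟺ 6150 ∧ 4659 ∧ 1982`** — each leaf of the split is necessary.
[cite: DuminilCopinICM2022, §8.4 p. 29] -/
theorem MoebiusLimit_iff_subs :
    CoerciveSharpness.MoebiusLimit ↔
      MirrorHoelderCompactness.TwoPointDoubling ∧ ClusterRigidity.ClusterSetTotallyDisconnected ∧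
        HyperoctahedralRP.InversionUpgradeNormalised := by
  rw [MoebiusLimitExistsTwoLeaf.coerciveSharpness_MoebiusLimit_iff_leaves,
    Cruxes.ExistsScaleCovariantLimit.FoldedCurrentRepulsion.crux_iff_doubling_and_totallyDisconnected, and_assoc]

/-- Necessity of the doubling leaf: `MoebiusLimit → TwoPointDoubling` (item 1344 ⟹ item 6150). [cite: DuminilCopinICM2022, §8.4 p. 29] -/
theorem twoPointDoubling_of_MoebiusLimit (h : CoerciveSharpness.MoebiusLimit) :
    MirrorHoelderCompactness.TwoPointDoubling :=
  (MoebiusLimit_iff_subs.mp h).1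

/-- Necessity of the cluster-set leaf: `MoebiusLimit → ClusterSetTotallyDisconnected` (item 1344 ⟹ item 4659).
[cite: DuminilCopinICM2022, §8.4 p. 29] -/
theorem clusterSetTotallyDisconnected_of_MoebiusLimit (h : CoerciveSharpness.MoebiusLimit) :
    ClusterRigidity.ClusterSetTotallyDisconnected :=
  (MoebiusLimit_iff_subs.mp h).2.1

/-- Necessity of the inversion leaf: `MoebiusLimit → InversionUpgradeNormalised` (item 1344 ⟹ item 1982).
[cite: DuminilCopinICM2022, §8.4 p. 29] -/
theorem inversionUpgradeNormalised_of_MoebiusLimit (h : CoerciveSharpness.MoebiusLimit) :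
    HyperoctahedralRP.InversionUpgradeNormalised :=
  (MoebiusLimit_iff_subs.mp h).2.2

/-- **On route `CoerciveSharpness` the imported complement reduces to two leaves**: given the route's own item
`DimensionPinned` (stmt-4662), `ClusterSetTotallyDisconnected` (stmt-4659) and `InversionUpgradeNormalised` (stmt-1982) give
`MoebiusLimit`. [cite: DuminilCopinICM2022, §8.4 p. 29] -/
theorem MoebiusLimit_of_dimensionPinned
    (h4662 : CoerciveSharpness.DimensionPinned)
    (h4659 : ClusterRigidity.ClusterSetTotallyDisconnected)
    (h1982 : HyperoctahedralRP.InversionUpgradeNormalised) :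
    CoerciveSharpness.MoebiusLimit :=
  MoebiusLimit_of_subs (twoPointDoubling_of_dimensionPinned h4662) h4659 h1982

/-- **The route's deciding theorem with the imported complement replaced by its two residual leaves**:
`PhiCoercive → CoerciveReflectedGradient → WindowOfGrowth → DimensionPinned → WindowForcesU4 →
ClusterSetTotallyDisconnected → InversionUpgradeNormalised → Ising3DConformalLimit` (composition with the route file's
`closes`). [cite: DuminilCopinICM2022, §8.4 p. 29] -/
theorem closes_residual
    (h₁ : CoerciveSharpness.PhiCoercive) (h₂ : CoerciveSharpness.CoerciveReflectedGradient)
    (h₃ : CoerciveSharpness.WindowOfGrowth) (h₄ : CoerciveSharpness.DimensionPinned)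
    (h₅ : CoerciveSharpness.WindowForcesU4)
    (h4659 : ClusterRigidity.ClusterSetTotallyDisconnected)
    (h1982 : HyperoctahedralRP.InversionUpgradeNormalised) :
    _root_.Ising3DConformalLimit :=
  CoerciveSharpness.closes h₁ h₂ h₃ h₄ h₅ (MoebiusLimit_of_dimensionPinned h₄ h4659 h1982)

end Summit.CriticalPhenomena.Ising3DConformalLimit.CoerciveSharpnessMoebiusLimitSplit

end
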